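import Mathlib.Analysis.InnerProductSpace.Calculus
import Mathlib.Analysis.InnerProductSpace.Laplacian
import Mathlib.Analysis.Calculus.ContDiff.Basic
import Mathlib.Analysis.Calculus.FDeriv.Mul
import Mathlib.Analysis.Calculus.Deriv.Comp
import Mathlib.Analysis.Calculus.Deriv.Mul
import Mathlib.Analysis.Calculus.Deriv.Add
import Mathlib.Analysis.SpecialFunctions.Sqrt
import Mathlib.LinearAlgebra.Matrix.SchurComplement
import Mathlib.Topology.Algebra.Module.Determinant
import Literature.Geometry.Lorentzian.Basic
import HarnessLib

/-!
# Far-cone retardation remainder, V: the Lorentz stretch of a travelling profile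

Support file 5 for the brick `SoftEraTubeLift.FarConeRetardationRemainder` of crux
`EIHFluxBalance.ModulatedKerrHandoff` (H′, stmt-FinalStateConjecture-17402; card `soft-era-tube-lift`).
A `C²` travelling profile `W` whose translate along a straight worldline of velocity `v₀`,
`‖v₀‖ < 1`, solves the flat wave equation with the comoving source satisfies the ELLIPTIC equation
`D²W(z)[v₀, v₀] − ΔW(z) = 4πM φ(z)` (`travelling_wave_elliptic`, the d'Alembertian taken in the
iterated-`deriv` convention of the crux sketch).  The symmetric rank-one STRETCH
`T = I − k v₀ ⊗ v₀`, `k = (1 + γ)⁻¹`, `γ = √(1 − ‖v₀‖²)` has `T² = I − v₀ ⊗ v₀`, `det T = γ`,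
inverse `S = I + (k/γ) v₀ ⊗ v₀` and `γ²‖S r‖² = (1 − ‖v₀‖²)‖r‖² + ⟪v₀, r⟫²` (the present-position
Liénard–Wiechert distance); it turns the elliptic operator into the Laplacian:
`Δ(W ∘ T)(z) = ΔW(Tz) − D²W(Tz)[v₀, v₀]` (`laplacian_comp_stretch`).  Also the rank-one determinant
`det(I + ⟪a, ·⟫u) = 1 + ⟪a, u⟫` (`det_id_add_smulRight`) used for both `T` and the retarded change of
variables.  Mathlib only. [folklore]
-/

noncomputable section

open Filter Topology InnerProductSpace Literature.Geometry.Lorentzian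
open scoped RealInnerProductSpace Laplacian

-- the doubled `FinalStateConjecture` path component is the summit/problem naming scheme
set_option linter.dupNamespace false

namespace Summit.FinalStateConjecture.FinalStateConjecture.Theorems.EIHFluxBalance.ModulatedKerrHandoffBricks.FarCone

/-! ### The rank-one determinant -/

/-- **Matrix determinant lemma on `E3`**: `det(I + ⟪a, ·⟫ u) = 1 + ⟪a, u⟫`. [folklore] -/
theorem det_id_add_smulRight (a u : E3) :
    (ContinuousLinearMap.id ℝ E3 + (innerSL ℝ a).smulRight u).det = 1 + ⟪a, u⟫ := by
  set f : E3 →L[ℝ] E3 := ContinuousLinearMap.id ℝ E3 + (innerSL ℝ a).smulRight u with hf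
  let b := (EuclideanSpace.basisFun (Fin 3) ℝ).toBasis
  have hdet : f.det = (LinearMap.toMatrix b b (f : E3 →ₗ[ℝ] E3)).det := by
    rw [LinearMap.det_toMatrix]
  have hmat : LinearMap.toMatrix b b (f : E3 →ₗ[ℝ] E3) =
      1 + Matrix.replicateCol Unit (fun i ↦ u i) * Matrix.replicateRow Unit (fun j ↦ a j) := by
    ext i j
    rw [LinearMap.toMatrix_apply]
    simp only [b, OrthonormalBasis.coe_toBasis, EuclideanSpace.basisFun_apply,
      OrthonormalBasis.coe_toBasis_repr_apply, EuclideanSpace.basisFun_repr, hf,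
      ContinuousLinearMap.coe_coe, add_apply, ContinuousLinearMap.id_apply,
      ContinuousLinearMap.smulRight_apply, innerSL_apply_apply, EuclideanSpace.inner_single_right,
      Matrix.add_apply, Matrix.mul_apply, Matrix.replicateCol_apply, Matrix.replicateRow_apply,
      Finset.univ_unique, Finset.sum_singleton, PiLp.add_apply, PiLp.smul_apply, smul_eq_mul,
      PiLp.single_apply, Matrix.one_apply, one_mul, RCLike.conj_to_real]
    split_ifs <;> ring
  rw [hdet, hmat, Matrix.det_one_add_replicateCol_mul_replicateRow]
  congr 1
  simp only [dotProduct, EuclideanSpace.inner_eq_star_dotProduct, star_trivial]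
  exact Finset.sum_congr rfl fun _ _ ↦ mul_comm _ _

/-! ### The stretch `T = I − k v₀ ⊗ v₀` -/

section Stretch

variable {v₀ : E3}

/-- `γ = √(1 − ‖v₀‖²)` is positive for `‖v₀‖ < 1`. [folklore] -/
theorem gamma_pos (hv : ‖v₀‖ < 1) : 0 < Real.sqrt (1 - ‖v₀‖ ^ 2) := by
  apply Real.sqrt_pos.2
  have h0 : 0 ≤ ‖v₀‖ := norm_nonneg _
  nlinarith

/-- `γ² = 1 − ‖v₀‖²`. [folklore] -/
theorem gamma_sq (hv : ‖v₀‖ < 1) : Real.sqrt (1 - ‖v₀‖ ^ 2) ^ 2 = 1 - ‖v₀‖ ^ 2 := by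
  apply Real.sq_sqrt
  have h0 : 0 ≤ ‖v₀‖ := norm_nonneg _
  nlinarith

/-- The key scalar identity of the stretch: `−2k + k²‖v₀‖² = −1`, `k = (1 + γ)⁻¹`. [folklore] -/
theorem stretch_scalar_identity (hv : ‖v₀‖ < 1) :
    -2 * (1 + Real.sqrt (1 - ‖v₀‖ ^ 2))⁻¹ + (1 + Real.sqrt (1 - ‖v₀‖ ^ 2))⁻¹ ^ 2 * ‖v₀‖ ^ 2 = -1 := by
  have hγ := gamma_pos hv
  have hγ2 := gamma_sq hv
  set γ := Real.sqrt (1 - ‖v₀‖ ^ 2)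
  have h1 : (1 + γ) ≠ 0 := by positivity
  field_simp
  nlinarith

/-- **`Σᵢ B(Teᵢ, Teᵢ) = Σᵢ B(eᵢ, eᵢ) − B(v₀, v₀)`** for every continuous bilinear form `B` on `E3`
and any orthonormal basis: the stretch has `T Tᵀ = I − v₀ ⊗ v₀`. [folklore] -/
theorem sum_bilin_stretch (hv : ‖v₀‖ < 1) (B : E3 →L[ℝ] E3 →L[ℝ] ℝ)
    (e : OrthonormalBasis (Fin 3) ℝ E3) :
    ∑ i, B ((ContinuousLinearMap.id ℝ E3 -
        (1 + Real.sqrt (1 - ‖v₀‖ ^ 2))⁻¹ • (innerSL ℝ v₀).smulRight v₀) (e i))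
      ((ContinuousLinearMap.id ℝ E3 -
        (1 + Real.sqrt (1 - ‖v₀‖ ^ 2))⁻¹ • (innerSL ℝ v₀).smulRight v₀) (e i)) =
      ∑ i, B (e i) (e i) - B v₀ v₀ := by
  set k : ℝ := (1 + Real.sqrt (1 - ‖v₀‖ ^ 2))⁻¹ with hk
  have hT : ∀ z : E3, (ContinuousLinearMap.id ℝ E3 - k • (innerSL ℝ v₀).smulRight v₀) z =
      z - (k * ⟪v₀, z⟫) • v₀ := fun z ↦ by
    simp only [sub_apply, ContinuousLinearMap.id_apply,
      FunLike.coe_smul, Pi.smul_apply, ContinuousLinearMap.smulRight_apply,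
      innerSL_apply_apply, smul_smul]
  simp_rw [hT]
  -- expand the bilinear form
  have hexp : ∀ i, B (e i - (k * ⟪v₀, e i⟫) • v₀) (e i - (k * ⟪v₀, e i⟫) • v₀) =
      B (e i) (e i) - (k * ⟪v₀, e i⟫) * B (e i) v₀ - (k * ⟪v₀, e i⟫) * B v₀ (e i) +
        (k * ⟪v₀, e i⟫) ^ 2 * B v₀ v₀ := fun i ↦ by
    simp only [map_sub, map_smul, sub_apply, FunLike.coe_smul,
      Pi.smul_apply, smul_eq_mul]
    ring
  simp_rw [hexp]
  rw [Finset.sum_add_distrib, Finset.sum_sub_distrib, Finset.sum_sub_distrib]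
  -- `Σ ⟪v₀, eᵢ⟫ B(eᵢ, v₀) = B(v₀, v₀)` etc. by `v₀ = Σ ⟪eᵢ, v₀⟫ eᵢ`
  have hv₀ : ∑ i, ⟪v₀, e i⟫ • e i = v₀ := by
    conv_rhs => rw [← e.sum_repr' v₀]
    refine Finset.sum_congr rfl fun i _ ↦ ?_
    rw [real_inner_comm]
  have h1 : ∑ i, k * ⟪v₀, e i⟫ * B (e i) v₀ = k * B v₀ v₀ := by
    have : B v₀ v₀ = ∑ i, ⟪v₀, e i⟫ * B (e i) v₀ := by
      calc B v₀ v₀ = B (∑ i, ⟪v₀, e i⟫ • e i) v₀ := by rw [hv₀]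
        _ = ∑ i, ⟪v₀, e i⟫ * B (e i) v₀ := by
            simp only [map_sum, map_smul, sum_apply, FunLike.coe_smul,
              Pi.smul_apply, smul_eq_mul]
    rw [this, Finset.mul_sum]
    refine Finset.sum_congr rfl fun i _ ↦ by ring
  have h2 : ∑ i, k * ⟪v₀, e i⟫ * B v₀ (e i) = k * B v₀ v₀ := by
    have : B v₀ v₀ = ∑ i, ⟪v₀, e i⟫ * B v₀ (e i) := by
      calc B v₀ v₀ = B v₀ (∑ i, ⟪v₀, e i⟫ • e i) := by rw [hv₀]
        _ = ∑ i, ⟪v₀, e i⟫ * B v₀ (e i) := by simp only [map_sum, map_smul, smul_eq_mul]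
    rw [this, Finset.mul_sum]
    refine Finset.sum_congr rfl fun i _ ↦ by ring
  have h3 : ∑ i, (k * ⟪v₀, e i⟫) ^ 2 * B v₀ v₀ = k ^ 2 * ‖v₀‖ ^ 2 * B v₀ v₀ := by
    have hn : ‖v₀‖ ^ 2 = ∑ i, ⟪v₀, e i⟫ ^ 2 := by
      rw [← e.sum_sq_norm_inner_left v₀]
      refine Finset.sum_congr rfl fun i _ ↦ by rw [Real.norm_eq_abs, sq_abs]
    rw [hn, Finset.mul_sum, Finset.sum_mul]
    refine Finset.sum_congr rfl fun i _ ↦ by ring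
  rw [h1, h2, h3]
  have key := stretch_scalar_identity hv
  rw [← hk] at key
  linear_combination (B v₀ v₀) * key

/-- **Determinant of the stretch**: `det T = γ`. [folklore] -/
theorem det_stretch (hv : ‖v₀‖ < 1) :
    (ContinuousLinearMap.id ℝ E3 -
        (1 + Real.sqrt (1 - ‖v₀‖ ^ 2))⁻¹ • (innerSL ℝ v₀).smulRight v₀).det =
      Real.sqrt (1 - ‖v₀‖ ^ 2) := by
  have hγ := gamma_pos hv
  have hγ2 := gamma_sq hv
  set γ := Real.sqrt (1 - ‖v₀‖ ^ 2) with hγdef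
  have hT : ContinuousLinearMap.id ℝ E3 - (1 + γ)⁻¹ • (innerSL ℝ v₀).smulRight v₀ =
      ContinuousLinearMap.id ℝ E3 + (innerSL ℝ (-(1 + γ)⁻¹ • v₀)).smulRight v₀ := by
    ext1 z
    simp only [add_apply, neg_apply, ContinuousLinearMap.id_apply, FunLike.coe_smul,
      Pi.smul_apply, ContinuousLinearMap.smulRight_apply, innerSL_apply_apply, inner_neg_left,
      real_inner_smul_left, neg_smul, smul_smul, sub_eq_add_neg]
  rw [hT, det_id_add_smulRight, real_inner_smul_left, real_inner_self_eq_norm_sq,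
    show ‖v₀‖ ^ 2 = 1 - γ ^ 2 by linarith [hγ2]]
  have h1 : (1 + γ) ≠ 0 := by positivity
  field_simp
  ring

/-- **The inverse stretch** `S = I + (k/γ) v₀ ⊗ v₀`: `T (S z) = z`. [folklore] -/
theorem stretch_apply_unstretch (hv : ‖v₀‖ < 1) (z : E3) :
    (ContinuousLinearMap.id ℝ E3 -
        (1 + Real.sqrt (1 - ‖v₀‖ ^ 2))⁻¹ • (innerSL ℝ v₀).smulRight v₀)
      ((ContinuousLinearMap.id ℝ E3 + ((1 + Real.sqrt (1 - ‖v₀‖ ^ 2))⁻¹ *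
        (Real.sqrt (1 - ‖v₀‖ ^ 2))⁻¹) • (innerSL ℝ v₀).smulRight v₀) z) = z := by
  have hγ := gamma_pos hv
  have hγ2 := gamma_sq hv
  set γ := Real.sqrt (1 - ‖v₀‖ ^ 2) with hγdef
  simp only [sub_apply, add_apply,
    ContinuousLinearMap.id_apply, FunLike.coe_smul, Pi.smul_apply,
    ContinuousLinearMap.smulRight_apply, innerSL_apply_apply, inner_add_right, real_inner_smul_right,
    real_inner_self_eq_norm_sq, smul_smul]
  -- `z + a • v₀ - b • v₀ = z` with `a = b`
  rw [add_sub_assoc, ← sub_smul]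
  have h1 : (1 + γ) ≠ 0 := by positivity
  have : (1 + γ)⁻¹ * γ⁻¹ * ⟪v₀, z⟫ -
      (1 + γ)⁻¹ * (⟪v₀, z⟫ + (1 + γ)⁻¹ * γ⁻¹ * ⟪v₀, z⟫ * ‖v₀‖ ^ 2) = 0 := by
    rw [show ‖v₀‖ ^ 2 = 1 - γ ^ 2 by linarith [hγ2]]
    field_simp
    ring
  rw [this, zero_smul, add_zero]

/-- **The inverse stretch**: `S (T z) = z`. [folklore] -/
theorem unstretch_apply_stretch (hv : ‖v₀‖ < 1) (z : E3) :
    (ContinuousLinearMap.id ℝ E3 + ((1 + Real.sqrt (1 - ‖v₀‖ ^ 2))⁻¹ *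
        (Real.sqrt (1 - ‖v₀‖ ^ 2))⁻¹) • (innerSL ℝ v₀).smulRight v₀)
      ((ContinuousLinearMap.id ℝ E3 -
        (1 + Real.sqrt (1 - ‖v₀‖ ^ 2))⁻¹ • (innerSL ℝ v₀).smulRight v₀) z) = z := by
  have hγ := gamma_pos hv
  have hγ2 := gamma_sq hv
  set γ := Real.sqrt (1 - ‖v₀‖ ^ 2) with hγdef
  simp only [sub_apply, add_apply,
    ContinuousLinearMap.id_apply, FunLike.coe_smul, Pi.smul_apply,
    ContinuousLinearMap.smulRight_apply, innerSL_apply_apply, inner_sub_right, real_inner_smul_right,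
    real_inner_self_eq_norm_sq, smul_smul]
  rw [sub_add_eq_add_sub, add_sub_assoc, ← sub_smul]
  have h1 : (1 + γ) ≠ 0 := by positivity
  have : (1 + γ)⁻¹ * γ⁻¹ * (⟪v₀, z⟫ - (1 + γ)⁻¹ * ⟪v₀, z⟫ * ‖v₀‖ ^ 2) - (1 + γ)⁻¹ * ⟪v₀, z⟫ = 0 := by
    rw [show ‖v₀‖ ^ 2 = 1 - γ ^ 2 by linarith [hγ2]]
    field_simp
    ring
  rw [this, zero_smul, add_zero]

/-- **The Liénard–Wiechert distance**: `γ² ‖S r‖² = (1 − ‖v₀‖²)‖r‖² + ⟪v₀, r⟫²`. [folklore] -/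
theorem gamma_sq_mul_norm_unstretch_sq (hv : ‖v₀‖ < 1) (r : E3) :
    Real.sqrt (1 - ‖v₀‖ ^ 2) ^ 2 *
        ‖(ContinuousLinearMap.id ℝ E3 + ((1 + Real.sqrt (1 - ‖v₀‖ ^ 2))⁻¹ *
          (Real.sqrt (1 - ‖v₀‖ ^ 2))⁻¹) • (innerSL ℝ v₀).smulRight v₀) r‖ ^ 2 =
      (1 - ‖v₀‖ ^ 2) * ‖r‖ ^ 2 + ⟪v₀, r⟫ ^ 2 := by
  have hγ := gamma_pos hv
  have hγ2 := gamma_sq hv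
  set γ := Real.sqrt (1 - ‖v₀‖ ^ 2) with hγdef
  simp only [add_apply, ContinuousLinearMap.id_apply,
    FunLike.coe_smul, Pi.smul_apply, ContinuousLinearMap.smulRight_apply,
    innerSL_apply_apply, smul_smul]
  rw [← real_inner_self_eq_norm_sq (r + _), inner_add_left, inner_add_right, inner_add_right,
    real_inner_smul_left, real_inner_smul_right, real_inner_smul_left, real_inner_smul_right,
    real_inner_self_eq_norm_sq, real_inner_self_eq_norm_sq, real_inner_comm r v₀]
  have h1 : (1 + γ) ≠ 0 := by positivity
  rw [show ‖v₀‖ ^ 2 = 1 - γ ^ 2 by linarith [hγ2]]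
  field_simp
  ring

end Stretch

/-! ### Second derivatives along lines; the travelling-wave dictionary -/

section Wave

variable {W : E3 → ℝ}

/-- `d/ds W(p + s a) = DW(p + s a)[a]`. [folklore] -/
theorem deriv_comp_line (hW : Differentiable ℝ W) (p a : E3) (s : ℝ) :
    deriv (fun s' : ℝ ↦ W (p + s' • a)) s = fderiv ℝ W (p + s • a) a := by
  have hl : HasDerivAt (fun s' : ℝ ↦ p + s' • a) a s := by
    simpa using ((hasDerivAt_id s).smul_const a).const_add p
  have h := (hW (p + s • a)).hasFDerivAt.comp_hasDerivAt s hl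
  exact h.deriv

/-- **`d²/ds² W(p + s a) = D²W(p + s a)[a, a]`** for `W ∈ C²`. [folklore] -/
theorem deriv_deriv_comp_line (hW : ContDiff ℝ 2 W) (p a : E3) (τ : ℝ) :
    deriv (fun s ↦ deriv (fun s' : ℝ ↦ W (p + s' • a)) s) τ =
      fderiv ℝ (fun q ↦ fderiv ℝ W q a) (p + τ • a) a := by
  have hD : Differentiable ℝ fun q ↦ fderiv ℝ W q a :=
    ((hW.fderiv_right (m := 1) (by norm_num)).clm_apply contDiff_const).differentiable one_ne_zero
  have h1 : (fun s ↦ deriv (fun s' : ℝ ↦ W (p + s' • a)) s) =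
      fun s ↦ (fun q ↦ fderiv ℝ W q a) (p + s • a) :=
    funext fun s ↦ deriv_comp_line (hW.differentiable two_ne_zero) p a s
  rw [h1]
  exact deriv_comp_line hD p a τ

/-- `D²W(z)[a, b]` is the second Fréchet derivative `D(DW)(z)[b][a]`. [folklore] -/
theorem fderiv_fderiv_apply (hW : ContDiff ℝ 2 W) (z a b : E3) :
    fderiv ℝ (fun q ↦ fderiv ℝ W q a) z b = fderiv ℝ (fderiv ℝ W) z b a := by
  have hd : DifferentiableAt ℝ (fderiv ℝ W) z :=
    ((hW.fderiv_right (m := 1) (by norm_num)).differentiable one_ne_zero) z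
  rw [fderiv_clm_apply hd (differentiableAt_const a)]
  simp

/-- **The travelling-wave dictionary.** If the translate of the `C²` profile `W` along the
straight worldline `s ↦ ξ₀ + (s − t₀)v₀` satisfies the flat wave equation (iterated-`deriv`
d'Alembertian, the convention of the crux sketch) with source `4πM φ` comoving, then
`D²W(z)[v₀, v₀] − ΔW(z) = 4πM φ(z)` for every `z`. [folklore] -/
theorem travelling_wave_elliptic {φ : E3 → ℝ} {ξ₀ v₀ : E3} {t₀ M : ℝ} (hW : ContDiff ℝ 2 W)
    (hwave : ∀ (t : ℝ) (x : E3),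
      deriv (fun s ↦ deriv (fun s' ↦ W (x - ξ₀ - (s' - t₀) • v₀)) s) t -
        ∑ i : Fin 3, deriv (fun s : ℝ ↦ deriv (fun s' : ℝ ↦
          W (x + s' • EuclideanSpace.single i (1 : ℝ) - ξ₀ - (t - t₀) • v₀)) s) (0 : ℝ) =
        4 * Real.pi * M * φ (x - ξ₀ - (t - t₀) • v₀))
    (z : E3) :
    fderiv ℝ (fun q ↦ fderiv ℝ W q v₀) z v₀ - (Δ W) z = 4 * Real.pi * M * φ z := by
  have h := hwave t₀ (z + ξ₀)
  simp only [sub_self, zero_smul, sub_zero, add_sub_cancel_right] at h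
  -- the time slice is the line through `p = z + t₀ v₀` with direction `-v₀`
  have htime : (fun s' : ℝ ↦ W (z - (s' - t₀) • v₀)) =
      fun s' ↦ W ((z + t₀ • v₀) + s' • (-v₀)) := by
    funext s'; congr 1; module
  have hspace : ∀ i : Fin 3, (fun s' : ℝ ↦ W (z + ξ₀ + s' • EuclideanSpace.single i (1 : ℝ) - ξ₀)) =
      fun s' ↦ W (z + s' • EuclideanSpace.single i (1 : ℝ)) := by
    intro i; funext s'; congr 1; module
  rw [htime] at h
  simp only [hspace, deriv_deriv_comp_line hW, zero_smul, add_zero] at h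
  have hp : z + t₀ • v₀ + t₀ • -v₀ = z := by module
  rw [hp] at h
  -- `D²W(z)[-v₀, -v₀] = D²W(z)[v₀, v₀]`
  have hneg : fderiv ℝ (fun q ↦ fderiv ℝ W q (-v₀)) z (-v₀) = fderiv ℝ (fun q ↦ fderiv ℝ W q v₀) z v₀ := by
    rw [fderiv_fderiv_apply hW, fderiv_fderiv_apply hW, map_neg, map_neg, neg_apply, neg_neg]
  rw [hneg] at h
  rw [laplacian_eq_sum_fderiv_fderiv_basisFun hW z]
  exact h
  where
  /-- `ΔW(z) = Σᵢ D²W(z)[eᵢ, eᵢ]` over the standard basis (Mathlib's Laplacian). [folklore] -/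
  laplacian_eq_sum_fderiv_fderiv_basisFun (hW : ContDiff ℝ 2 W) (z : E3) :
      (Δ W) z = ∑ i : Fin 3, fderiv ℝ (fun q ↦ fderiv ℝ W q (EuclideanSpace.single i (1 : ℝ))) z
        (EuclideanSpace.single i (1 : ℝ)) := by
    rw [laplacian_eq_iteratedFDeriv_orthonormalBasis W (EuclideanSpace.basisFun (Fin 3) ℝ)]
    refine Finset.sum_congr rfl fun i _ ↦ ?_
    rw [EuclideanSpace.basisFun_apply, iteratedFDeriv_two_apply, fderiv_fderiv_apply hW]
    simp

/-- **Laplacian under the stretch**: `Δ(W ∘ T)(z) = ΔW(Tz) − D²W(Tz)[v₀, v₀]` for `W ∈ C²` and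
the stretch `T = I − (1 + γ)⁻¹ v₀ ⊗ v₀`, `‖v₀‖ < 1`. [folklore] -/
theorem laplacian_comp_stretch {v₀ : E3} (hW : ContDiff ℝ 2 W) (hv : ‖v₀‖ < 1) (z : E3) :
    (Δ (fun q : E3 ↦ W ((ContinuousLinearMap.id ℝ E3 -
        (1 + Real.sqrt (1 - ‖v₀‖ ^ 2))⁻¹ • (innerSL ℝ v₀).smulRight v₀) q))) z =
      (Δ W) ((ContinuousLinearMap.id ℝ E3 -
        (1 + Real.sqrt (1 - ‖v₀‖ ^ 2))⁻¹ • (innerSL ℝ v₀).smulRight v₀) z) -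
      fderiv ℝ (fun q ↦ fderiv ℝ W q v₀) ((ContinuousLinearMap.id ℝ E3 -
        (1 + Real.sqrt (1 - ‖v₀‖ ^ 2))⁻¹ • (innerSL ℝ v₀).smulRight v₀) z) v₀ := by
  set T : E3 →L[ℝ] E3 := ContinuousLinearMap.id ℝ E3 -
    (1 + Real.sqrt (1 - ‖v₀‖ ^ 2))⁻¹ • (innerSL ℝ v₀).smulRight v₀ with hT
  have hWd : Differentiable ℝ W := hW.differentiable two_ne_zero
  have hWT : ContDiff ℝ 2 fun q : E3 ↦ W (T q) := hW.comp T.contDiff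
  -- first derivatives of `W ∘ T`
  have h1 : ∀ (q a : E3), fderiv ℝ (fun q' : E3 ↦ W (T q')) q a = fderiv ℝ W (T q) (T a) := by
    intro q a
    have hc := (hWd (T q)).hasFDerivAt.comp q T.hasFDerivAt
    rw [show (fun q' : E3 ↦ W (T q')) = W ∘ ⇑T from rfl, hc.fderiv]
    rfl
  -- second derivatives of `W ∘ T`
  have h2 : ∀ a b : E3, fderiv ℝ (fun q ↦ fderiv ℝ (fun q' : E3 ↦ W (T q')) q a) z b =
      fderiv ℝ (fderiv ℝ W) (T z) (T b) (T a) := by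
    intro a b
    have hfun : (fun q ↦ fderiv ℝ (fun q' : E3 ↦ W (T q')) q a) =
        (fun p ↦ fderiv ℝ W p (T a)) ∘ ⇑T := funext fun q ↦ h1 q a
    have hD : Differentiable ℝ fun p ↦ fderiv ℝ W p (T a) :=
      ((hW.fderiv_right (m := 1) (by norm_num)).clm_apply contDiff_const).differentiable one_ne_zero
    rw [hfun, ((hD (T z)).hasFDerivAt.comp z T.hasFDerivAt).fderiv, ContinuousLinearMap.comp_apply,
      fderiv_fderiv_apply hW]
  rw [travelling_wave_elliptic.laplacian_eq_sum_fderiv_fderiv_basisFun hWT,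
    travelling_wave_elliptic.laplacian_eq_sum_fderiv_fderiv_basisFun hW, fderiv_fderiv_apply hW]
  simp_rw [h2, fderiv_fderiv_apply hW]
  have key := sum_bilin_stretch hv (fderiv ℝ (fderiv ℝ W) (T z)) (EuclideanSpace.basisFun (Fin 3) ℝ)
  simp only [EuclideanSpace.basisFun_apply] at key
  rw [← hT] at key
  exact key

end Wave

/-! ### Registered form -/

/-- **The travelling-wave dictionary** (registered helper of stmt-FinalStateConjecture-17402, brick
`FarConeRetardationRemainder`): a `C²` travelling profile solving the flat wave equation with a
comoving source solves `D²W[v₀, v₀] − ΔW = 4πM φ`. [folklore] -/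
theorem farCone_travelling_wave_elliptic : ∀ (W φ : EuclideanSpace ℝ (Fin 3) → ℝ) (ξ₀ v₀ : EuclideanSpace ℝ (Fin 3)) (t₀ M : ℝ), ContDiff ℝ 2 W → (∀ (t : ℝ) (x : EuclideanSpace ℝ (Fin 3)), deriv (fun s ↦ deriv (fun s' ↦ W (x - ξ₀ - (s' - t₀) • v₀)) s) t - ∑ i : Fin 3, deriv (fun s : ℝ ↦ deriv (fun s' : ℝ ↦ W (x + s' • EuclideanSpace.single i (1 : ℝ) - ξ₀ - (t - t₀) • v₀)) s) (0 : ℝ) = 4 * Real.pi * M * φ (x - ξ₀ - (t - t₀) • v₀)) → ∀ z : EuclideanSpace ℝ (Fin 3), fderiv ℝ (fun q ↦ fderiv ℝ W q v₀) z v₀ - (Laplacian.laplacian W : EuclideanSpace ℝ (Fin 3) → ℝ) z = 4 * Real.pi * M * φ z :=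
  fun _W _φ _ξ₀ _v₀ _t₀ _M hW hwave z ↦ travelling_wave_elliptic hW hwave z

end Summit.FinalStateConjecture.FinalStateConjecture.Theorems.EIHFluxBalance.ModulatedKerrHandoffBricks.FarCone

end
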